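import Summits.AnomalousDissipation.AnomalousDissipation.Theorems.SolenoidalFractalHomogenisationLagrangianStepVmodFrameDefsJA
import Literature.Analysis.FunctionSpaces.TorusScalarFourierSeries
import Literature.Analysis.FunctionSpaces.TorusSpectralWeakDerivative
import HarnessLib

/-!
# K1L_D (stmt-AnomalousDissipation-27980), (ℓ3-A) road A, (G2)(iii) «cross-band tails» in the (F6) form: the frame symbols are BANDED in the class index —
# `|Ĝ(t)_{ij}(q)| ≤ θ·(nC/(2π|q_c|))^m`, `|Ĵ(t)_{ij}(q)| ≤ 2θ·(nC/(2π|q_c|))^m` for `1 ≤ m ≤ 6` from `IsFrameRegular6`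
(helper, `--supports 27980 --as helper`; prover lead-k1l-onelevel-p1 g8; RULINGS D28-22 (2), D28-22′ ((R-L24-2) token = F6, p3's pick), memo L24 §3 (G2)(iii).)

Pure Fourier bookkeeping (no definitions, no named facts): Grafakos's `𝓕(∂_c^m g)(q) = (2πi q_c)^m ĝ(q)` (tree: `Torus.norm_mFourierCoeff_le_of_partialDeriv_iterate`)
turns the graded sup bounds of the (F6) token into coordinatewise polynomial decay of the Fourier coefficients of every frame entry, at every order `1 ≤ m ≤ 6`
and every window time:
* `norm_mFourierCoeff_ofReal_le_of_iterPartialDeriv_replicate` — generic: `|∂_c^m g| ≤ B` everywhere ⇒ `‖𝓕(g)(q)‖ ≤ B/(2π|q_c|)^m` (`q_c ≠ 0`), real `g` complexified;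
* `IsFrameRegular6.norm_mFourierCoeff_frame_le` — for `t ∈ [0,Tw]`, smooth entries: the two displayed bounds.
This is the (G2)(iii) ingredient of the one-period distorted slot ladder (L24 §3): with the head's `nC ≤ ϱ₁(ν/K)^{4/3} n` the tail across the gap `Δ` between the
low band and the high-slow band is `θ·(nC/Δ)^6`.  Block provers (p3 (S2), k3l) instantiate `m`, `c`, `q`.  NOT a proof of any block, of K1L_D or of AD; rung F-D1.A0.
-/

set_option linter.dupNamespace false

noncomputable section

namespace Summit.AnomalousDissipation.AnomalousDissipation.Theorems.SolenoidalFractalHomogenisation.LagrangianStep.FrameInst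

open Set Function
open UnitAddTorus (mFourierCoeff)
open Literature.Analysis Literature.Analysis.FunctionSpaces Literature.Analysis.FunctionSpaces.Torus
open Summit.AnomalousDissipation.AnomalousDissipation.Theorems.SolenoidalFractalHomogenisation.LagrangianStep.VmodDist

section General

variable {d : Type*} [Fintype d] [DecidableEq d]

/-- `∂_c^[m] (g : ℂ) = (∂^{replicate m c} g : ℂ)` for smooth real `g`. [folklore] -/
theorem partialDeriv_iterate_ofReal_eq (g : UnitAddTorus d → ℝ) (hg : IsSmooth g) (c : d) :
    ∀ m : ℕ, (partialDeriv c)^[m] (fun y => (g y : ℂ)) = fun y => ((iterPartialDeriv (List.replicate m c) g y : ℝ) : ℂ)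
  | 0 => by funext y; simp
  | m + 1 => by
    rw [Function.iterate_succ', Function.comp_apply, partialDeriv_iterate_ofReal_eq g hg c m, List.replicate_succ, iterPartialDeriv_cons]
    funext y
    exact partialDeriv_ofReal_comp (hg.iterPartialDeriv _) c y

/-- **Coordinatewise Fourier decay from a sup bound on one pure iterated derivative**: if `|∂^{replicate m c} g| ≤ B` everywhere then
`‖𝓕(g)(q)‖ ≤ B/(2π|q_c|)^m` for `q_c ≠ 0` (real `g`, complexified). [cite: Grafakos2014, Thm. 3.3.9] -/
theorem norm_mFourierCoeff_ofReal_le_of_iterPartialDeriv_replicate {g : UnitAddTorus d → ℝ} (hg : IsSmooth g) (c : d) (m : ℕ) {B : ℝ}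
    (hB : ∀ y, |iterPartialDeriv (List.replicate m c) g y| ≤ B) {q : d → ℤ} (hq : q c ≠ 0) :
    ‖mFourierCoeff (fun y => (g y : ℂ)) q‖ ≤ B / (2 * Real.pi * |(q c : ℝ)|) ^ m := by
  refine norm_mFourierCoeff_le_of_partialDeriv_iterate hg.ofReal_comp c m hq fun y => ?_
  rw [partialDeriv_iterate_ofReal_eq g hg c m]
  simp only [Complex.norm_real, Real.norm_eq_abs]
  exact hB y

end General

/-- **(G2)(iii), F6 form: the frame symbols are banded in the class index.**  If `IsFrameRegular6 θ Tw nC G J` and the entries of `G t`, `J t` are smooth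
(`IsFrameModulation.smooth`, `IsFrameRegular.smooth`), then for `t ∈ [0,Tw]`, `1 ≤ m ≤ 6`, every coordinate `c` and every class index `q` with `q_c ≠ 0`:
`‖𝓕(G(t)_{ij})(q)‖ ≤ θ·nC^m/(2π|q_c|)^m` and `‖𝓕(J(t)_{ij})(q)‖ ≤ 2θ·nC^m/(2π|q_c|)^m`. -/
theorem IsFrameRegular6.norm_mFourierCoeff_frame_le {θ Tw nC : ℝ} {G J : ℝ → UnitAddTorus (Fin 3) → Matrix (Fin 3) (Fin 3) ℝ}
    (h : IsFrameRegular6 θ Tw nC G J) {t : ℝ} (ht : t ∈ Icc 0 Tw) (i j : Fin 3)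
    (hGs : IsSmooth (fun y => G t y i j)) (hJs : IsSmooth (fun y => J t y i j))
    (c : Fin 3) {m : ℕ} (hm1 : 1 ≤ m) (hm6 : m ≤ 6) {q : Fin 3 → ℤ} (hq : q c ≠ 0) :
    ‖mFourierCoeff (fun y => (G t y i j : ℂ)) q‖ ≤ θ * nC ^ m / (2 * Real.pi * |(q c : ℝ)|) ^ m ∧
      ‖mFourierCoeff (fun y => (J t y i j : ℂ)) q‖ ≤ 2 * θ * nC ^ m / (2 * Real.pi * |(q c : ℝ)|) ^ m := by
  have hlen : (List.replicate m c).length = m := List.length_replicate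
  have hb := fun y => h.derivBound6 t ht y i j (List.replicate m c) (by rw [hlen]; exact hm1) (by rw [hlen]; exact hm6)
  refine ⟨norm_mFourierCoeff_ofReal_le_of_iterPartialDeriv_replicate hGs c m (fun y => ?_) hq,
    norm_mFourierCoeff_ofReal_le_of_iterPartialDeriv_replicate hJs c m (fun y => ?_) hq⟩
  · have := (hb y).1; rwa [hlen] at this
  · have := (hb y).2; rwa [hlen] at this

end Summit.AnomalousDissipation.AnomalousDissipation.Theorems.SolenoidalFractalHomogenisation.LagrangianStep.FrameInst

end
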